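import Summits.QuantumFields.YangMills.Theorems.BalabanUVNodesPortS1ChartJacobian

/-!
# NODE O port PT-A — socket (o2) = brick (h2), MANY BONDS: print's «∫dV … = 𝐍* ∫ dB′σ(B′) …» ([I] (2.1) ↦ (2.10) p.267) for the product Haar measure of a FINITE BOND SET at ANY centre `U₀` —
# `(⊗_b dU(b))|_{{U : U(b) = exp(iA_b)·U₀(b), |A_b| < s}} = σ₀^{#bonds} • (A ↦ (exp(iA_b)·U₀(b))_b)_*((Π_b chartJac(A_b)) · dA|_{|A_b|<s ∀ b})`, `s ≤ π`, `dA` Lebesgue measure on `bonds → ℝ³`,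
# `chartJac = σ∕σ₀ = (sin|A|∕|A|)²` (✓`…PortS1ChartJacobian`), `σ(B′) := Π_b chartJac(B′(b))` print's Jacobian with «the factors σ₀ included into the normalization factor»

Cell `ym-nodeO-ideate`, porter seat `ymgap-nodeO-port-PTA-1` (gen 9, lead of the line `pta-residueW` of ⟨stmt-QuantumFields-27930⟩); `--kind definition --supports stmt-QuantumFields-27930 --as helper`
(★★★ director-ym №576 DISPATCH (o2) = (h2); ★★ DEF-1 g39 (D5)).  Sequel of ✓`…PortS1ChartJacobian` (ONE BOND: `chartJac`, `chartAt u A = expPauli A · u`, `haar_restrict_chartAt_image`; folklore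
`pi_withDensity`); the reading at DEF-1's flat record coordinates is the next sequel `…PortS1ChartJacobianRecord`.  [I] = [Balaban1987RG1] (2.4) p.266, (2.10) p.267; [16] = [Balaban1985UV3]
(13) p.259, (18) p.260.

CONTENT (sorry-free; Mathlib + BUILT tree only): def `chartPi U₀ A := (expPauli (A b) · U₀ b)_b` (print's `V = V′V^{(k)}` on a bond set), ★ def `fluctSigma A := Π_b chartJac (A b)` (print's `σ(B′)`
of (2.10), `σ₀` factored out; `_nonneg`, `_le_one`, `_zero`, `continuous_`, `measurable_`, `ofReal_fluctSigma`), `image_chartPi_pi_ball`, `pi_sigmaMeasure_restrict_ball` (`⊗_b σdA|_{B_s} =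
σ₀^{#ι} • σ(A)·dA|_{B_s^ι}`), ★★★ `pi_haar_restrict_chartPi_image` (MEASURE FORM), ★★★ `setLIntegral_pi_haar_chartPi_image` (every measurable `G ≥ 0`), ★★ `setIntegral_pi_haar_chartPi_image`
(Bochner, real Banach values).

HONEST FRAMING.  Measure-theoretic bookkeeping (Mathlib `Measure.restrict_pi_pi` ∕ `pi_map_pi` over the one-bond identity); NOTHING of Bałaban's renormalization-group estimates asserted, ported or
discharged; (o1) `D̃`, (o3), (o4) NOT here; `stub_P0C` ∕ `stub_FE` OPEN; ⟨27930⟩ ⁸-Ax-LR4 OPEN · no claim; NODE O 0∕1; COUNT 8∕28 · K 1∕4 UNMOVED; finite `𝕋⁴_{L^K}` at fixed ε — NOT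
continuum ∕ OS ∕ Clay; **the Yang–Mills mass gap is NOT proved by any of this.**  No `sorry`, no `instance`, no `notation`; standard axioms.
-/

noncomputable section

open MeasureTheory MeasureTheory.Measure Set Metric
open scoped ENNReal BigOperators

namespace Summit.QuantumFields.YangMills.Theorems.BalabanUVNodesPortS1

open Literature.MathematicalPhysics.QuantumFieldTheory (haarProbability)
open Literature.MathematicalPhysics.QuantumFieldTheory.Balaban1983to89
open Literature.MathematicalPhysics.QuantumFieldTheory.Balaban1983to89.B10Eq22Rescaling (sigmaSU2 sigmaSU2_zero)
open Literature.MathematicalPhysics.QuantumFieldTheory.Balaban1983to89.B10Eq18SigmaSU2Haar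

/-! ## §2  MANY BONDS: the product chart centred at a configuration `U₀`, print's `σ(B′) = Π_b (σ∕σ₀)(|B′(b)|)`, and `(⊗_b dU(b))` on the product window -/

section ManyBonds

variable {ι : Type*}

/-- print's `V = V′V^{(k)}` ON A FINITE BOND SET: the product Pauli chart centred at the configuration `U₀`, `(A_b)_b ↦ (exp(iA_b)·U₀(b))_b`. [cite: Balaban1987RG1, (2.4) p.266] -/
def chartPi (U₀ : ι → Matrix.specialUnitaryGroup (Fin 2) ℂ) (A : ι → EuclideanSpace ℝ (Fin 3)) : ι → Matrix.specialUnitaryGroup (Fin 2) ℂ :=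
  fun b => chartAt (U₀ b) (A b)

/-- Unfolding. [cite: Balaban1987RG1, (2.4) p.266] -/
theorem chartPi_apply (U₀ : ι → Matrix.specialUnitaryGroup (Fin 2) ℂ) (A : ι → EuclideanSpace ℝ (Fin 3)) (b : ι) : chartPi U₀ A b = expPauli (A b) * U₀ b := rfl

/-- At `A = 0` the product chart sits at its centre. [cite: Balaban1987RG1, (2.4) p.266] -/
theorem chartPi_zero (U₀ : ι → Matrix.specialUnitaryGroup (Fin 2) ℂ) : chartPi U₀ 0 = U₀ := funext fun b => chartAt_zero (U₀ b)

/-- `chartPi U₀` is measurable. [folklore] -/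
theorem measurable_chartPi (U₀ : ι → Matrix.specialUnitaryGroup (Fin 2) ℂ) : Measurable (chartPi U₀) :=
  measurable_pi_lambda _ fun b => (measurable_chartAt (U₀ b)).comp (measurable_pi_apply b)

/-- The product window `{U : U(b) ∈ exp(iB_s)·U₀(b) ∀ b}` is the image of the product ball under the product chart. [folklore] -/
theorem image_chartPi_pi_ball (U₀ : ι → Matrix.specialUnitaryGroup (Fin 2) ℂ) (s : ℝ) :
    chartPi U₀ '' Set.pi univ (fun _ => ball (0 : EuclideanSpace ℝ (Fin 3)) s) = Set.pi univ fun b => chartAt (U₀ b) '' ball (0 : EuclideanSpace ℝ (Fin 3)) s := by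
  classical
  ext U
  simp only [mem_image, mem_univ_pi]
  constructor
  · rintro ⟨A, hA, rfl⟩ b
    exact ⟨A b, hA b, rfl⟩
  · intro h
    choose A hA hAU using h
    exact ⟨A, hA, funext hAU⟩

variable [Fintype ι]

/-- ★ **print's `σ(B′)` of (2.10) with the factors `σ₀` taken out**: `fluctSigma A := Π_b chartJac (A b) = Π_b (sin|A_b|∕|A_b|)²`. [cite: Balaban1987RG1, (2.10) p.267] -/
def fluctSigma (A : ι → EuclideanSpace ℝ (Fin 3)) : ℝ := ∏ b, chartJac (A b)

/-- `0 ≤ σ(B′)`. [cite: Balaban1987RG1, (2.10) p.267] -/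
theorem fluctSigma_nonneg (A : ι → EuclideanSpace ℝ (Fin 3)) : 0 ≤ fluctSigma A := Finset.prod_nonneg fun b _ => chartJac_nonneg (A b)

/-- `σ(B′) ≤ 1`. [cite: Balaban1987RG1, (2.10) p.267] -/
theorem fluctSigma_le_one (A : ι → EuclideanSpace ℝ (Fin 3)) : fluctSigma A ≤ 1 :=
  Finset.prod_le_one (fun b _ => chartJac_nonneg (A b)) fun b _ => chartJac_le_one (A b)

/-- `σ(0) = 1`. [cite: Balaban1987RG1, (2.10) p.267] -/
theorem fluctSigma_zero : fluctSigma (0 : ι → EuclideanSpace ℝ (Fin 3)) = 1 := by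
  simp only [fluctSigma, Pi.zero_apply, chartJac_zero, Finset.prod_const_one]

/-- `σ(B′)` is continuous. [folklore] -/
theorem continuous_fluctSigma : Continuous (fluctSigma : (ι → EuclideanSpace ℝ (Fin 3)) → ℝ) :=
  continuous_finsetProd _ fun b _ => continuous_chartJac.comp (continuous_apply b)

/-- `σ(B′)` is measurable. [folklore] -/
theorem measurable_fluctSigma : Measurable (fluctSigma : (ι → EuclideanSpace ℝ (Fin 3)) → ℝ) := continuous_fluctSigma.measurable

/-- `ofReal (σ(B′)) = Π_b ofReal (chartJac (B′(b)))`. [folklore] -/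
theorem ofReal_fluctSigma (A : ι → EuclideanSpace ℝ (Fin 3)) : ENNReal.ofReal (fluctSigma A) = ∏ b, ENNReal.ofReal (chartJac (A b)) :=
  ENNReal.ofReal_prod_of_nonneg fun b _ => chartJac_nonneg (A b)

/-- `A ↦ ofReal (σ(A))` is measurable. [folklore] -/
theorem measurable_ofReal_fluctSigma : Measurable fun A : ι → EuclideanSpace ℝ (Fin 3) => ENNReal.ofReal (fluctSigma A) :=
  measurable_fluctSigma.ennreal_ofReal

/-- `Π_b σ_{SU(2)}(|A_b|) = σ₀^{#ι} · Π_b chartJac(A_b)` in `ℝ≥0∞`. [cite: Balaban1987RG1, (2.10) p.267] -/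
theorem prod_ofReal_sigmaSU2_eq (A : ι → EuclideanSpace ℝ (Fin 3)) :
    ∏ b, ENNReal.ofReal (sigmaSU2 ‖A b‖) = ENNReal.ofReal (sigmaSU2 0) ^ Fintype.card ι * ENNReal.ofReal (fluctSigma A) := by
  simp only [ofReal_sigmaSU2_eq, Finset.prod_mul_distrib, Finset.prod_const, Finset.card_univ, ofReal_fluctSigma]

/-- **`⊗_b σ(A_b)dA_b` ON THE PRODUCT WINDOW IS `σ₀^{#ι} · σ(B′) · dB′`**: `⊗_b (σ dA|_{B_s}) = σ₀^{#ι} • (fluctSigma · (d A)|_{B_s^ι})`, `d A` Lebesgue measure on `ι → ℝ³`, `s ≤ π`.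
[cite: Balaban1987RG1, (2.10) p.267] [cite: Balaban1985UV3, (18) p.260] -/
theorem pi_sigmaMeasure_restrict_ball {s : ℝ} (hs : s ≤ Real.pi) :
    Measure.pi (fun _ : ι => sigmaMeasure.restrict (ball (0 : EuclideanSpace ℝ (Fin 3)) s)) =
      ENNReal.ofReal (sigmaSU2 0) ^ Fintype.card ι •
        ((volume : Measure (ι → EuclideanSpace ℝ (Fin 3))).restrict (Set.pi univ fun _ => ball (0 : EuclideanSpace ℝ (Fin 3)) s)).withDensity
          fun A => ENNReal.ofReal (fluctSigma A) := by
  haveI : IsProbabilityMeasure sigmaMeasure := isProbabilityMeasure_sigmaMeasure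
  haveI : IsFiniteMeasure ((volume.restrict (ball (0 : EuclideanSpace ℝ (Fin 3)) s)).withDensity fun A => ENNReal.ofReal (sigmaSU2 ‖A‖)) := by
    rw [← sigmaMeasure_restrict_ball hs]; infer_instance
  have h1 : Measure.pi (fun _ : ι => sigmaMeasure.restrict (ball (0 : EuclideanSpace ℝ (Fin 3)) s)) =
      Measure.pi (fun _ : ι => (volume.restrict (ball (0 : EuclideanSpace ℝ (Fin 3)) s)).withDensity fun A => ENNReal.ofReal (sigmaSU2 ‖A‖)) := by
    simp only [sigmaMeasure_restrict_ball hs]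
  rw [h1, pi_withDensity (fun _ : ι => volume.restrict (ball (0 : EuclideanSpace ℝ (Fin 3)) s)) (fun _ => measurable_sigmaSU2_norm.ennreal_ofReal) (fun _ => 0),
    ← Measure.restrict_pi_pi, ← volume_pi]
  have h2 : (fun A : ι → EuclideanSpace ℝ (Fin 3) => ∏ b, ENNReal.ofReal (sigmaSU2 ‖A b‖)) =
      ENNReal.ofReal (sigmaSU2 0) ^ Fintype.card ι • fun A => ENNReal.ofReal (fluctSigma A) := by
    funext A
    rw [Pi.smul_apply, smul_eq_mul, prod_ofReal_sigmaSU2_eq]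
  rw [h2, withDensity_smul _ measurable_ofReal_fluctSigma]

/-- ★★★ **THE PRODUCT HAAR MEASURE ON A TRANSLATED PRODUCT WINDOW (measure form)**: for every centre `U₀ : ι → SU(2)` and `s ≤ π`,
`(⊗_b dU(b))|_{{U : U(b) = exp(iA_b)·U₀(b), |A_b| < s}} = σ₀^{#ι} • (A ↦ (exp(iA_b)·U₀(b))_b)_*(σ(A) · d A|_{|A_b|<s ∀ b})` — print's «∫dV … = 𝐍* ∫ dB′σ(B′) …» ((2.1) ↦ (2.10)) as an
identity of measures, the `σ₀`'s displayed. [cite: Balaban1987RG1, (2.4) p.266, (2.10) p.267] [cite: Balaban1985UV3, (18) p.260] -/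
theorem pi_haar_restrict_chartPi_image (U₀ : ι → Matrix.specialUnitaryGroup (Fin 2) ℂ) {s : ℝ} (hs : s ≤ Real.pi) :
    (Measure.pi fun _ : ι => haarProbability (Matrix.specialUnitaryGroup (Fin 2) ℂ)).restrict
        (Set.pi univ fun b => chartAt (U₀ b) '' ball (0 : EuclideanSpace ℝ (Fin 3)) s) =
      ENNReal.ofReal (sigmaSU2 0) ^ Fintype.card ι •
        (((volume : Measure (ι → EuclideanSpace ℝ (Fin 3))).restrict (Set.pi univ fun _ => ball (0 : EuclideanSpace ℝ (Fin 3)) s)).withDensity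
          fun A => ENNReal.ofReal (fluctSigma A)).map (chartPi U₀) := by
  haveI : IsProbabilityMeasure sigmaMeasure := isProbabilityMeasure_sigmaMeasure
  haveI : ∀ b : ι, IsFiniteMeasure ((sigmaMeasure.restrict (ball (0 : EuclideanSpace ℝ (Fin 3)) s)).map (chartAt (U₀ b))) := fun b => by
    rw [← haar_restrict_chartAt_image (U₀ b) hs]; infer_instance
  rw [Measure.restrict_pi_pi]
  have h1 : Measure.pi (fun b : ι => (haarProbability (Matrix.specialUnitaryGroup (Fin 2) ℂ)).restrict (chartAt (U₀ b) '' ball (0 : EuclideanSpace ℝ (Fin 3)) s)) =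
      Measure.pi (fun b : ι => (sigmaMeasure.restrict (ball (0 : EuclideanSpace ℝ (Fin 3)) s)).map (chartAt (U₀ b))) := by
    congr 1
    funext b
    exact haar_restrict_chartAt_image (U₀ b) hs
  rw [h1, ← Measure.pi_map_pi (fun b => (measurable_chartAt (U₀ b)).aemeasurable), pi_sigmaMeasure_restrict_ball hs, Measure.map_smul]
  rfl

/-- ★★★ **THE PRODUCT HAAR MEASURE ON A TRANSLATED PRODUCT WINDOW, EVERY MEASURABLE INTEGRAND**: for `U₀ : ι → SU(2)`, `s ≤ π`, measurable `G ≥ 0`,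
`∫_{{U(b) ∈ exp(iB_s)·U₀(b) ∀ b}} G d(⊗_b dU(b)) = σ₀^{#ι} · ∫_{|A_b|<s ∀ b} G((exp(iA_b)·U₀(b))_b) · Π_b chartJac(A_b) dA` — [I] (2.1) ↦ (2.10) for the bond variables of a finite bond set.
[cite: Balaban1987RG1, (2.4) p.266, (2.10) p.267] [cite: Balaban1985UV3, (13) p.259, (18) p.260] -/
theorem setLIntegral_pi_haar_chartPi_image (U₀ : ι → Matrix.specialUnitaryGroup (Fin 2) ℂ) {s : ℝ} (hs : s ≤ Real.pi)
    (G : (ι → Matrix.specialUnitaryGroup (Fin 2) ℂ) → ℝ≥0∞) (hG : Measurable G) :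
    ∫⁻ U in Set.pi univ (fun b => chartAt (U₀ b) '' ball (0 : EuclideanSpace ℝ (Fin 3)) s), G U ∂(Measure.pi fun _ : ι => haarProbability (Matrix.specialUnitaryGroup (Fin 2) ℂ)) =
      ENNReal.ofReal (sigmaSU2 0) ^ Fintype.card ι *
        ∫⁻ A in Set.pi univ (fun _ => ball (0 : EuclideanSpace ℝ (Fin 3)) s), G (chartPi U₀ A) * ENNReal.ofReal (fluctSigma A) := by
  rw [pi_haar_restrict_chartPi_image U₀ hs, lintegral_smul_measure, smul_eq_mul, lintegral_map hG (measurable_chartPi U₀),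
    lintegral_withDensity_eq_lintegral_mul_non_measurable _ measurable_ofReal_fluctSigma (Filter.Eventually.of_forall fun _ => ENNReal.ofReal_lt_top) _]
  congr 1
  refine lintegral_congr fun A => ?_
  rw [Pi.mul_apply, mul_comm]

/-- ★★ **BOCHNER FORM**: for `U₀ : ι → SU(2)`, `s ≤ π` and `f` a.e.-strongly measurable on the window (real Banach values),
`∫_{window} f d(⊗_b dU(b)) = σ₀^{#ι} · ∫_{|A_b|<s ∀ b} σ(A) • f((exp(iA_b)·U₀(b))_b) dA` (`σ = fluctSigma`). [cite: Balaban1987RG1, (2.4) p.266, (2.10) p.267] [cite: Balaban1985UV3, (18) p.260] -/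
theorem setIntegral_pi_haar_chartPi_image {G : Type*} [NormedAddCommGroup G] [NormedSpace ℝ G] (U₀ : ι → Matrix.specialUnitaryGroup (Fin 2) ℂ) {s : ℝ} (hs : s ≤ Real.pi)
    (f : (ι → Matrix.specialUnitaryGroup (Fin 2) ℂ) → G)
    (hf : AEStronglyMeasurable f ((Measure.pi fun _ : ι => haarProbability (Matrix.specialUnitaryGroup (Fin 2) ℂ)).restrict
      (Set.pi univ fun b => chartAt (U₀ b) '' ball (0 : EuclideanSpace ℝ (Fin 3)) s))) :
    ∫ U in Set.pi univ (fun b => chartAt (U₀ b) '' ball (0 : EuclideanSpace ℝ (Fin 3)) s), f U ∂(Measure.pi fun _ : ι => haarProbability (Matrix.specialUnitaryGroup (Fin 2) ℂ)) =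
      (sigmaSU2 0) ^ Fintype.card ι •
        ∫ A in Set.pi univ (fun _ => ball (0 : EuclideanSpace ℝ (Fin 3)) s), fluctSigma A • f (chartPi U₀ A) := by
  have h0 : 0 < sigmaSU2 0 := by rw [sigmaSU2_zero]; positivity
  have hc : ENNReal.ofReal (sigmaSU2 0) ^ Fintype.card ι ≠ 0 := pow_ne_zero _ (ENNReal.ofReal_pos.2 h0).ne'
  have hμ := pi_haar_restrict_chartPi_image U₀ hs
  rw [hμ] at hf
  have hf' := hf.mono_ac (Measure.absolutelyContinuous_smul hc)
  show ∫ U, f U ∂((Measure.pi fun _ : ι => haarProbability (Matrix.specialUnitaryGroup (Fin 2) ℂ)).restrict _) = _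
  rw [hμ, integral_smul_measure, integral_map (measurable_chartPi U₀).aemeasurable hf',
    integral_withDensity_eq_integral_toReal_smul measurable_ofReal_fluctSigma (Filter.Eventually.of_forall fun _ => ENNReal.ofReal_lt_top),
    ENNReal.toReal_pow, ENNReal.toReal_ofReal h0.le]
  congr 1
  refine integral_congr_ae (Filter.Eventually.of_forall fun A => ?_)
  simp only [ENNReal.toReal_ofReal (fluctSigma_nonneg A)]

end ManyBonds

end Summit.QuantumFields.YangMills.Theorems.BalabanUVNodesPortS1

end
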